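import Literature.Geometry.GeometricMeasureTheory.CurrentsProofs
import Mathlib.Topology.ContinuousMap.SecondCountableSpace
import Mathlib.Topology.UniformSpace.CompactConvergence
import Mathlib.LinearAlgebra.Multilinear.FiniteDimensional

/-!
# Weak sequential compactness of mass-bounded currents

The Banach–Alaoglu core of the Federer–Fleming compactness theorem [Federer1969, 4.2.17]: on an
open subset `Ω` of a finite-dimensional real normed space, every sequence of currents `Tᵢ` with
`𝐌(Tᵢ) ≤ c < ∞` has a subsequence converging weakly (`Tᵢ(φ) → T'(φ)` for every test form `φ`) to
a current `T'` with `𝐌(T') ≤ c`; likewise with `𝐍 = 𝐌 + 𝐌 ∘ ∂` in place of `𝐌`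
(`Current.exists_subseq_tendsto_of_mass_le`, `Current.exists_subseq_tendsto_of_normalMass_le`);
weak limits do not enlarge supports (`Current.support_subset_of_tendsto`), whence the WEAK FORM
of the Federer–Fleming compactness statement (`Federer1969_compactness_weakForm`: subsequence,
weak limit with `spt ⊆ 𝐁(x₀, ρ)` and `𝐍 ≤ c`; integrality of the limit and flat convergence are
the closure and deformation theorems, not proved here).

Ingredients, proved here for Mathlib's test functions `𝓓^{n}(Ω, F)`:
* `exists_compact_exhaustion` — compact sets `K j ⊆ Ω` absorbing every compact subset of `Ω`;
* `TestFunction.exists_countable_sup_dense` — a countable family of test functions that is dense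
  for the supremum norm (second countability of `C(E, F)` with the compact-open topology,
  applied on each `K j`);
* the diagonal argument in `ℝ^ℕ` (`isCompact_univ_pi`, sequential compactness), the `3ε` Cauchy
  argument, and continuity of the limit functional from the bound `|T'(φ)| ≤ c ‖φ‖_∞`
  (universal property of the LF topology is not needed: a linear functional dominated by the
  continuous seminorm `‖·‖_∞` is continuous).

Source: H. Federer, *Geometric Measure Theory*, Springer 1969 (`Federer1969`), 4.2.17 (1) (whose
full statement — `𝐅_K`-compactness of `𝐍`-bounded normal currents — additionally uses the
deformation theorem); the weak-compactness step is the standard Banach–Alaoglu argument.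
-/

open scoped Distributions ENNReal NNReal Topology BoundedContinuousFunction
open MeasureTheory TopologicalSpace Set Filter

namespace Literature.Geometry.GeometricMeasureTheory

-- Nested operator-norm instances on (duals of) `E [⋀^Fin m]→L[ℝ] ℝ`, as in `Currents.lean`.
set_option maxSynthPendingDepth 2

/-! ### A compact exhaustion of an open set, and sup-norm separability of test functions -/

section Separable

variable {E : Type*} [NormedAddCommGroup E] [NormedSpace ℝ E] [FiniteDimensional ℝ E]
  {F : Type*} [NormedAddCommGroup F] [NormedSpace ℝ F]

/-- An open subset `Ω` of a finite-dimensional space is exhausted by compact sets `K j ⊆ Ω` such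
that every compact `L ⊆ Ω` lies in some `K j`. [folklore] -/
theorem exists_compact_exhaustion (Ω : Opens E) :
    ∃ K : ℕ → Set E, (∀ j, IsCompact (K j)) ∧ (∀ j, K j ⊆ (Ω : Set E)) ∧
      ∀ L : Set E, IsCompact L → L ⊆ (Ω : Set E) → ∃ j, L ⊆ K j := by
  haveI : LocallyCompactSpace ↥(Ω : Set E) := Ω.isOpen.locallyCompactSpace
  obtain ⟨K'⟩ : Nonempty (CompactExhaustion ↥(Ω : Set E)) := ⟨CompactExhaustion.choice _⟩
  refine ⟨fun j => ((↑) : ↥(Ω : Set E) → E) '' K' j,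
    fun j => (K'.isCompact j).image continuous_subtype_val, fun j => ?_, fun L hL hLΩ => ?_⟩
  · rintro _ ⟨x, -, rfl⟩
    exact x.2
  · have hL' : IsCompact (((↑) : ↥(Ω : Set E) → E) ⁻¹' L) := by
      refine Topology.IsEmbedding.subtypeVal.isCompact_iff.2 ?_
      rwa [image_preimage_eq_inter_range, Subtype.range_coe, inter_eq_left.2 hLΩ]
    obtain ⟨j, hj⟩ := K'.exists_superset_of_isCompact hL'
    exact ⟨j, fun x hx => ⟨⟨x, hLΩ hx⟩, hj (show (⟨x, hLΩ hx⟩ : ↥(Ω : Set E)) ∈ _ from hx), rfl⟩⟩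

variable [SecondCountableTopology F] {Ω : Opens E} {n : ℕ∞}

/-- Test functions supported in a fixed compact set `K` are sup-norm separable: there is a countable
set of test functions `D` such that every `φ` with `spt φ ⊆ K` is within `ε` of some `d ∈ D`
uniformly (restriction to `K` embeds them into the second countable space `C(E, F)` with the
topology of compact convergence). [folklore] -/
theorem TestFunction.exists_countable_sup_dense_of_isCompact {K : Set E} (hK : IsCompact K) :
    ∃ D : Set 𝓓^{n}(Ω, F), D.Countable ∧ ∀ φ : 𝓓^{n}(Ω, F), tsupport ⇑φ ⊆ K →
      ∀ ε : ℝ, 0 < ε → ∃ d ∈ D, ∀ x, ‖φ x - d x‖ ≤ ε := by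
  let S : Set C(E, F) := (fun φ : 𝓓^{n}(Ω, F) => (φ : C(E, F))) '' {φ | tsupport ⇑φ ⊆ K}
  obtain ⟨D₀, hD₀c, hD₀d⟩ := TopologicalSpace.exists_countable_dense (↥S)
  have hpre : ∀ g : ↥S, ∃ φ : 𝓓^{n}(Ω, F), tsupport ⇑φ ⊆ K ∧ (φ : C(E, F)) = g := fun g => by
    obtain ⟨φ, hφ, h⟩ := g.2
    exact ⟨φ, hφ, h⟩
  choose pre hpre hpre' using hpre
  refine ⟨pre '' D₀, hD₀c.image _, fun φ hφ ε hε => ?_⟩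
  have hφS : (φ : C(E, F)) ∈ S := ⟨φ, hφ, rfl⟩
  -- the basic entourage of compact convergence on `K` at scale `ε`
  have hV : {fg : C(E, F) × C(E, F) | ∀ x ∈ K, (fg.1 x, fg.2 x) ∈ {p : F × F | dist p.1 p.2 < ε}}
      ∈ uniformity C(E, F) :=
    ContinuousMap.hasBasis_compactConvergenceUniformity.mem_of_mem
      (i := (K, {p : F × F | dist p.1 p.2 < ε})) ⟨hK, Metric.dist_mem_uniformity hε⟩
  have hN : ((↑) : ↥S → C(E, F)) ⁻¹' UniformSpace.ball (φ : C(E, F))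
      {fg : C(E, F) × C(E, F) | ∀ x ∈ K, (fg.1 x, fg.2 x) ∈ {p : F × F | dist p.1 p.2 < ε}}
        ∈ 𝓝 (⟨φ, hφS⟩ : ↥S) :=
    continuous_subtype_val.continuousAt.preimage_mem_nhds (UniformSpace.ball_mem_nhds _ hV)
  obtain ⟨g, hgD, hgN⟩ := hD₀d.inter_nhds_nonempty hN
  refine ⟨pre g, mem_image_of_mem _ hgD, fun x => ?_⟩
  by_cases hx : x ∈ K
  · have h1 : dist ((φ : C(E, F)) x) ((g : C(E, F)) x) < ε := hgN x hx
    rw [← hpre' g] at h1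
    exact (dist_eq_norm (φ x) (pre g x) ▸ h1).le
  · have h1 : φ x = 0 := image_eq_zero_of_notMem_tsupport fun h => hx (hφ h)
    have h2 : pre g x = 0 := image_eq_zero_of_notMem_tsupport fun h => hx (hpre g h)
    rw [h1, h2, sub_zero, norm_zero]
    exact hε.le

/-- **Sup-norm separability of test functions**: on an open subset of a finite-dimensional space
there is a countable set `D` of test functions such that every test function is a uniform limit of
members of `D`. [folklore] -/
theorem TestFunction.exists_countable_sup_dense (Ω : Opens E) (n : ℕ∞) :
    ∃ D : Set 𝓓^{n}(Ω, F), D.Countable ∧ ∀ (φ : 𝓓^{n}(Ω, F)) (ε : ℝ), 0 < ε →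
      ∃ d ∈ D, ∀ x, ‖φ x - d x‖ ≤ ε := by
  obtain ⟨K, hKc, -, hKabs⟩ := exists_compact_exhaustion Ω
  choose D hDc hD using fun j =>
    TestFunction.exists_countable_sup_dense_of_isCompact (Ω := Ω) (F := F) (n := n) (hKc j)
  refine ⟨⋃ j, D j, countable_iUnion hDc, fun φ ε hε => ?_⟩
  obtain ⟨j, hj⟩ := hKabs _ φ.hasCompactSupport φ.tsupport_subset
  obtain ⟨d, hd, h⟩ := hD j φ hj ε hε
  exact ⟨d, mem_iUnion.2 ⟨j, hd⟩, h⟩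

end Separable

/-! ### Weak sequential compactness of mass-bounded currents -/

section WeakCompactness

variable {E : Type*} [NormedAddCommGroup E] [NormedSpace ℝ E] {Ω : Opens E} {m : ℕ}

/-- `|T(φ)| ≤ 𝐌(T) · ‖φ‖_∞` for currents of finite mass, with the supremum norm of the test form as a
bounded continuous function. [cite: Federer1969, 4.1.7] -/
theorem Current.abs_apply_le_toReal_mass_mul_norm (T : Current Ω m) (hT : T.mass ≠ ∞)
    (φ : TestForm Ω m) : |T φ| ≤ T.mass.toReal * ‖(φ : E →ᵇ Covector E m)‖ := by
  rcases (norm_nonneg (φ : E →ᵇ Covector E m)).eq_or_lt with h0 | hpos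
  · have hφ : φ = 0 := by
      have h1 : (φ : E →ᵇ Covector E m) = 0 := norm_eq_zero.1 h0.symm
      exact TestFunction.ext fun x => (DFunLike.congr_fun h1 x : _)
    rw [← h0, mul_zero, hφ, map_zero, abs_zero]
  · have h := T.abs_apply_le_mul_toReal_mass hT hpos
      fun x => BoundedContinuousFunction.norm_coe_le_norm (φ : E →ᵇ Covector E m) x
    rwa [mul_comm] at h

variable [FiniteDimensional ℝ E]

/-- Second countability of the fibre of `m`-covectors over a finite-dimensional space (it is
finite-dimensional: continuous alternating maps embed into multilinear maps). [folklore] -/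
private theorem secondCountableTopology_covector : SecondCountableTopology (Covector E m) := by
  let L : (Covector E m) →ₗ[ℝ] MultilinearMap ℝ (fun _ : Fin m => E) ℝ :=
    { toFun := fun f => f.toContinuousMultilinearMap.toMultilinearMap
      map_add' := fun _ _ => rfl
      map_smul' := fun _ _ => rfl }
  have hL : Function.Injective L := fun f g h =>
    ContinuousAlternatingMap.ext fun v => (DFunLike.congr_fun h v : _)
  haveI : FiniteDimensional ℝ (Covector E m) := Module.Finite.of_injective L hL
  haveI : ProperSpace (Covector E m) := FiniteDimensional.proper ℝ _
  infer_instance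

/-- **Weak sequential compactness of mass-bounded currents** (Banach–Alaoglu for `𝒟_m(Ω)`): if
`𝐌(Tᵢ) ≤ c < ∞` for all `i`, some subsequence converges weakly to a current `T'` with `𝐌(T') ≤ c`.
[cite: Federer1969, 4.2.17 (1)] -/
theorem Current.exists_subseq_tendsto_of_mass_le (T : ℕ → Current Ω m) {c : ℝ≥0∞} (hc : c ≠ ⊤)
    (hT : ∀ i, (T i).mass ≤ c) :
    ∃ (T' : Current Ω m) (ι : ℕ → ℕ), StrictMono ι ∧
      (∀ φ, Tendsto (fun j => T (ι j) φ) atTop (𝓝 (T' φ))) ∧ T'.mass ≤ c := by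
  haveI : SecondCountableTopology (Covector E m) := secondCountableTopology_covector
  -- uniform bound `|Tᵢ(φ)| ≤ c' ‖φ‖_∞` with `c' = c.toReal`
  obtain ⟨c', hc'⟩ : ∃ c' : ℝ, c.toReal = c' := ⟨_, rfl⟩
  have hc'0 : 0 ≤ c' := hc' ▸ ENNReal.toReal_nonneg
  have hci : ∀ i, (T i).mass.toReal ≤ c' := fun i => hc' ▸ ENNReal.toReal_mono hc (hT i)
  have hTi : ∀ i, (T i).mass ≠ ∞ := fun i => ne_top_of_le_ne_top hc (hT i)
  have hbound : ∀ i (φ : TestForm Ω m), |T i φ| ≤ c' * ‖(φ : E →ᵇ Covector E m)‖ :=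
    fun i φ => ((T i).abs_apply_le_toReal_mass_mul_norm (hTi i) φ).trans
      (mul_le_mul_of_nonneg_right (hci i) (norm_nonneg _))
  -- a countable sup-dense family, enumerated
  obtain ⟨D, hDc, hD⟩ := TestFunction.exists_countable_sup_dense (F := Covector E m) Ω ⊤
  have hDne : D.Nonempty := by
    obtain ⟨d, hd, -⟩ := hD 0 1 one_pos
    exact ⟨d, hd⟩
  obtain ⟨d, rfl⟩ := hDc.exists_eq_range hDne
  -- the diagonal argument: `k ↦ Tᵢ(d k)` lives in the compact metrisable box `∏ [-c'‖d k‖, c'‖d k‖]`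
  obtain ⟨v, hv⟩ : ∃ v : ℕ → ℕ → ℝ, ∀ i k, v i k = T i (d k) := ⟨_, fun _ _ => rfl⟩
  have hvS : ∀ i, v i ∈ Set.pi univ fun k =>
      Icc (-(c' * ‖(d k : E →ᵇ Covector E m)‖)) (c' * ‖(d k : E →ᵇ Covector E m)‖) :=
    fun i k _ => by rw [hv]; exact abs_le.1 (hbound i (d k))
  obtain ⟨a, -, ι, hι, hlim⟩ := (isCompact_univ_pi fun k => isCompact_Icc).isSeqCompact hvS
  have hlimk : ∀ k, Tendsto (fun j => T (ι j) (d k)) atTop (𝓝 (a k)) := fun k => by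
    have h := tendsto_pi_nhds.1 hlim k
    simp only [Function.comp_def, hv] at h
    exact h
  -- every `Tᵢ(φ)` along `ι` is Cauchy, hence convergent
  have hcauchy : ∀ φ : TestForm Ω m, CauchySeq fun j => T (ι j) φ := by
    intro φ
    refine Metric.cauchySeq_iff.2 fun ε hε => ?_
    -- choose `η` with `(2 c' + 1) η < ε` and `d k` with `‖φ - d k‖_∞ ≤ η`
    obtain ⟨η, hη0, hηε⟩ : ∃ η : ℝ, 0 < η ∧ 2 * c' * η + η < ε := by
      refine ⟨ε / (2 * c' + 2), div_pos hε (by linarith), ?_⟩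
      have h1 : (2 * c' + 2) * (ε / (2 * c' + 2)) = ε := by field_simp
      nlinarith [div_pos hε (show (0 : ℝ) < 2 * c' + 2 by linarith)]
    obtain ⟨_, ⟨k, rfl⟩, hk⟩ := hD φ η hη0
    have hk' : ∀ x, ‖(φ - d k) x‖ ≤ η := fun x => by rw [sub_apply]; exact hk x
    have hdiff : ∀ i, |T i (φ - d k)| ≤ η * c' := fun i =>
      ((T i).abs_apply_le_mul_toReal_mass (hTi i) hη0 hk').trans
        (mul_le_mul_of_nonneg_left (hci i) hη0.le)
    obtain ⟨N, hN⟩ := Metric.cauchySeq_iff.1 (hlimk k).cauchySeq η hη0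
    refine ⟨N, fun p hp q hq => ?_⟩
    have h1 := hdiff (ι p)
    have h2 := hdiff (ι q)
    have h3 := hN p hp q hq
    rw [Real.dist_eq] at h3 ⊢
    have e1 : T (ι p) φ - T (ι q) φ =
        T (ι p) (φ - d k) + (T (ι p) (d k) - T (ι q) (d k)) - T (ι q) (φ - d k) := by
      simp only [map_sub]; ring
    rw [e1]
    calc |T (ι p) (φ - d k) + (T (ι p) (d k) - T (ι q) (d k)) - T (ι q) (φ - d k)|
        ≤ |T (ι p) (φ - d k)| + |T (ι p) (d k) - T (ι q) (d k)| + |T (ι q) (φ - d k)| :=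
          (abs_sub _ _).trans (add_le_add (abs_add_le _ _) le_rfl)
      _ < ε := by nlinarith
  choose L hL using fun φ => cauchySeq_tendsto_of_complete (hcauchy φ)
  -- the limit functional is linear …
  have hLadd : ∀ φ ψ, L (φ + ψ) = L φ + L ψ := fun φ ψ =>
    tendsto_nhds_unique (hL (φ + ψ)) (by simpa only [map_add] using (hL φ).add (hL ψ))
  have hLsmul : ∀ (r : ℝ) φ, L (r • φ) = r • L φ := fun r φ =>
    tendsto_nhds_unique (hL (r • φ)) (by simpa only [map_smul] using (hL φ).const_smul r)
  let Llin : TestForm Ω m →ₗ[ℝ] ℝ := ⟨⟨L, hLadd⟩, hLsmul⟩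
  -- … bounded by `c' ‖·‖_∞`, hence continuous
  have hLbound : ∀ φ, |L φ| ≤ c' * ‖(φ : E →ᵇ Covector E m)‖ := fun φ =>
    le_of_tendsto' ((continuous_abs.tendsto _).comp (hL φ)) fun j => hbound (ι j) φ
  have hLcont : Continuous Llin := by
    refine continuous_of_continuousAt_zero Llin ?_
    change Tendsto L (𝓝 0) (𝓝 (L 0))
    have hL0 : L 0 = 0 := by simpa using hLsmul 0 0
    rw [hL0]
    have hB : Tendsto (fun φ : TestForm Ω m => c' * ‖(φ : E →ᵇ Covector E m)‖) (𝓝 0) (𝓝 0) := by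
      have h0 := (TestFunction.toBoundedContinuousFunctionCLM ℝ :
        TestForm Ω m →L[ℝ] (E →ᵇ Covector E m)).continuous.tendsto 0
      rw [map_zero] at h0
      have h1 := h0.norm.const_mul c'
      rw [norm_zero, mul_zero] at h1
      exact h1
    exact squeeze_zero_norm (fun φ => by simpa [Real.norm_eq_abs] using hLbound φ) hB
  refine ⟨⟨Llin, hLcont⟩, ι, hι, hL, ?_⟩
  -- mass bound by lower semicontinuity
  exact (Current.mass_le_liminf (T := fun j => T (ι j)) hL).trans
    (liminf_le_of_frequently_le' (Frequently.of_forall fun j => hT (ι j)))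

/-- **Weak sequential compactness of `𝐍`-bounded currents**: if `𝐍(Tᵢ) = 𝐌(Tᵢ) + 𝐌(∂Tᵢ) ≤ c < ∞`
for all `i`, some subsequence converges weakly, together with its boundaries, to a current `T'`
with `𝐍(T') ≤ c`. [cite: Federer1969, 4.2.17 (1)] -/
theorem Current.exists_subseq_tendsto_of_normalMass_le (T : ℕ → Current Ω (m + 1)) {c : ℝ≥0∞}
    (hc : c ≠ ⊤) (hT : ∀ i, (T i).normalMass ≤ c) :
    ∃ (T' : Current Ω (m + 1)) (ι : ℕ → ℕ), StrictMono ι ∧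
      (∀ φ, Tendsto (fun j => T (ι j) φ) atTop (𝓝 (T' φ))) ∧
      (∀ φ, Tendsto (fun j => (T (ι j)).boundary φ) atTop (𝓝 (T'.boundary φ))) ∧
      T'.normalMass ≤ c := by
  obtain ⟨T', ι, hι, hT', -⟩ := Current.exists_subseq_tendsto_of_mass_le T hc
    fun i => le_trans (self_le_add_right _ _) (hT i)
  refine ⟨T', ι, hι, hT', Current.tendsto_boundary_apply hT', ?_⟩
  exact (Current.normalMass_le_liminf (T := fun j => T (ι j)) hT').trans
    (liminf_le_of_frequently_le' (Frequently.of_forall fun j => hT (ι j)))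

end WeakCompactness

/-! ### Supports of weak limits; the weak form of the compactness statement -/

section WeakLimitSupport

variable {E : Type*} [NormedAddCommGroup E] [NormedSpace ℝ E] [FiniteDimensional ℝ E]
  {Ω : Opens E} {m : ℕ}

/-- **Weak limits do not enlarge supports**: if `Tᵢ → T'` weakly and every `spt Tᵢ` lies in the
closed set `C`, then `spt T' ⊆ C` (test forms supported off `C` are killed by every `Tᵢ`,
`Current.apply_eq_zero_of_disjoint_support`). [cite: Federer1969, 4.1.1] -/
theorem Current.support_subset_of_tendsto {ι : Type*} {l : Filter ι} [l.NeBot]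
    {T : ι → Current Ω m} {T' : Current Ω m} (h : ∀ φ, Tendsto (fun i => T i φ) l (𝓝 (T' φ)))
    {C : Set E} (hC : IsClosed C) (hT : ∀ i, (T i).support ⊆ C) : T'.support ⊆ C := by
  intro x hx
  by_contra hxC
  obtain ⟨φ, hφ, hne⟩ := hx.2 Cᶜ (hC.isOpen_compl.mem_nhds hxC)
  apply hne
  have h0 : ∀ i, T i φ = 0 := fun i =>
    (T i).apply_eq_zero_of_disjoint_support
      (Set.disjoint_left.2 fun y hy hy' => hφ hy (hT i hy'))
  exact tendsto_nhds_unique (h φ) (by simp only [h0]; exact tendsto_const_nhds)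

end WeakLimitSupport

section WeakForm

universe u

variable {V : Type u} [NormedAddCommGroup V] [InnerProductSpace ℝ V] [FiniteDimensional ℝ V] {m : ℕ}

/-- **The weak form of the Federer–Fleming compactness statement.** For a sequence of
`(m+1)`-currents on `V` supported in `𝐁(x₀, ρ)` with `𝐍(Tᵢ) ≤ c < ∞` (no integrality needed), some
subsequence converges weakly, together with the boundaries, to a current `T'` with
`spt T' ⊆ 𝐁(x₀, ρ)` and `𝐍(T') ≤ c` (`Current.exists_subseq_tendsto_of_normalMass_le`, lower
semicontinuity, `Current.support_subset_of_tendsto`). What 4.2.17 (2) adds — and what is not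
proved here — is that for INTEGRAL `Tᵢ` the limit is integral (closure theorem 4.2.16) and the
convergence holds in the flat norm (deformation theorem 4.2.9). [cite: Federer1969, 4.2.17] -/
theorem Federer1969_compactness_weakForm (x₀ : V) (ρ : ℝ) (c : ℝ≥0∞) (hc : c ≠ ⊤)
    (T : ℕ → Current (⊤ : Opens V) (m + 1))
    (hT : ∀ i, (T i).support ⊆ Metric.closedBall x₀ ρ ∧ (T i).normalMass ≤ c) :
    ∃ (T' : Current (⊤ : Opens V) (m + 1)) (ι : ℕ → ℕ), StrictMono ι ∧
      T'.support ⊆ Metric.closedBall x₀ ρ ∧ T'.normalMass ≤ c ∧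
      (∀ φ, Tendsto (fun j => T (ι j) φ) atTop (𝓝 (T' φ))) ∧
      ∀ φ, Tendsto (fun j => (T (ι j)).boundary φ) atTop (𝓝 (T'.boundary φ)) := by
  obtain ⟨T', ι, hι, hw, hwb, hN⟩ :=
    Current.exists_subseq_tendsto_of_normalMass_le T hc fun i => (hT i).2
  exact ⟨T', ι, hι, Current.support_subset_of_tendsto hw Metric.isClosed_closedBall
    fun j => (hT (ι j)).1, hN, hw, hwb⟩

end WeakForm


end Literature.Geometry.GeometricMeasureTheory
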